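import Summits.NavierStokesRegularity.FluidComputer.ClayBlowupRows
import HarnessLib

/-!
# The energy of a Clay blow-up is Leray–Hopf on closed sub-slabs, obeys the forced energy equality,
# and is CONTINUOUS THROUGH the lifespan

Cell `ns-blowup`, seat `ns-blowup-ecbridge-2` (g5; the E–C endpoint theory seat). LABEL: E–C typing
(KERNEL — no named fact). WHAT THIS IS NOT: not Navier–Stokes evidence — necessary conditions on the
TYPE `ClayBlowup` (no inhabitant is claimed anywhere), hence on every breakdown scenario for (C).
Companion memo: `run/shared/lean/pub/ns-blowup/ecbridge2/ECBRIDGE-2-MEMO-4.md` §2 (R10).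

## Content (row R10 completed on the weak type; the `DesignedBlowup` twins are g4's
`DesignedBlowupEnergyClass.lean`)

For `X : ClayBlowup ν`, `ν > 0`:
* `isLerayHopfOn` — Leray–Hopf WITH force on every closed sub-slab `[0, T']`, and `u ∈ C([0,T'];L²)`;
* `energyEq` — `½‖u(t)‖₂² + ν∫ₛᵗ∫|∇u|² = ½‖u(s)‖₂² + ∫ₛᵗ∫⟪f,u⟫` for `0 ≤ s ≤ t < T`;
* `kineticEnergy_sub_le` — ONE `M` with `½‖u(t)‖₂² ≤ ½‖u(s)‖₂² + M(t − s)` on `[0, T)`;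
* **`tendsto_kineticEnergy`** — the kinetic energy HAS A LIMIT at the lifespan: the end of the
  finite-energy classical evolution is invisible in the energy (no jump, no oscillation).

References: J. Leray, Acta Math. 63 (1934), §17 [cite: Leray1934, §17]; T. Tao, Anal. PDE 6 (2013),
Lemma 8.1 + Lemma 4.1 (i) [cite: Tao2011, Lemma 8.1]; C. L. Fefferman, Clay problem description, (C)
[cite: FeffermanClay2006, (C)].
-/

noncomputable section

namespace Summit.NavierStokesRegularity.FluidComputer

namespace ClayBlowup

open Set MeasureTheory Filter Topology Function
open scoped ENNReal NNReal RealInnerProductSpace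
open Literature.Analysis.FluidPDE
open Summit.NavierStokesRegularity.FluidComputer.PalasekTowerClayBridge

variable {ν : ℝ} (X : ClayBlowup ν)

/-- The force of a Clay blow-up has `L²` slices bounded uniformly in `t ≥ 0`. [cite: FeffermanClay2006, (5)] -/
theorem force_slice_sq_le : ∃ C₀ : ℝ≥0, ∀ t, 0 ≤ t → ∫⁻ x, ‖X.f t x‖ₑ ^ 2 ≤ C₀ := by
  obtain ⟨C₀, -, -, -, hC₀, -, -⟩ :=
    ForcedContinuation.exists_force_slice_bounds X.force_smooth X.force_decay
  exact ⟨C₀, hC₀⟩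

/-- The midpoint `(t + T)/2` of `t ∈ [0, T)` and `T` is a legitimate slab end. [folklore] -/
theorem midpoint_slab {t : ℝ} (ht : t ∈ Ico 0 X.T) :
    0 < (t + X.T) / 2 ∧ t ≤ (t + X.T) / 2 ∧ (t + X.T) / 2 < X.T := by
  obtain ⟨ht0, htT⟩ := ht
  have hT := X.T_pos
  refine ⟨by linarith, by linarith, by linarith⟩

/-- **A Clay blow-up is a Leray–Hopf weak solution WITH force on every closed sub-slab** `[0, T']`,
`0 < T' < T`, from its own datum, and `u ∈ C([0,T'];L²)` (lean g5's fact-free packaging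
`isLerayHopfOn_of_finiteEnergy_forced_L2`). No named fact. [cite: Tao2011, Lemma 8.1 + Lemma 4.1 (i)] -/
theorem isLerayHopfOn (hν : 0 < ν) {T' : ℝ} (hT'0 : 0 < T') (hT' : T' < X.T) :
    IsLerayHopfOn T' ν X.f (X.u 0) X.u ∧ ContinuousInLpOn (Icc 0 T') 2 X.u := by
  obtain ⟨C₀, hC₀⟩ := X.force_slice_sq_le
  exact (X.classical_Icc hT'0 hT').isLerayHopfOn_of_finiteEnergy_forced_L2 hν hT'0
    (Cf := C₀) ENNReal.coe_ne_top (fun t ht => hC₀ t ht.1) (X.energy T' hT')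

/-- **The forced energy EQUALITY along a Clay blow-up**: for `0 ≤ s ≤ t < T`,
`½‖u(t)‖₂² + ν∫ₛᵗ∫|∇u|² = ½‖u(s)‖₂² + ∫ₛᵗ∫⟪f,u⟫`. No named fact. [cite: Leray1934, §17]
[cite: Tao2011, Lemma 8.1] -/
theorem energyEq (hν : 0 < ν) {s t : ℝ} (hs : 0 ≤ s) (hst : s ≤ t) (ht : t < X.T) :
    VectorCalculus.kineticEnergy (X.u t) +
      ν * (∫⁻ τ in Ioo s t, ∫⁻ x, ENNReal.ofReal (frobeniusNormSq (fderiv ℝ (X.u τ) x))).toReal =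
      VectorCalculus.kineticEnergy (X.u s) + ∫ τ in Ioo s t, ∫ x, ⟪X.f τ x, X.u τ x⟫ := by
  obtain ⟨C₀, hC₀⟩ := X.force_slice_sq_le
  obtain ⟨h0, htm, hmT⟩ := X.midpoint_slab ⟨hs.trans hst, ht⟩
  obtain ⟨A, hAt, hA⟩ := X.energy _ hmT
  exact ((X.classical_Icc h0 hmT).energyEq_of_finiteEnergy_forced_L2_of_energy hν h0
    (Cf := C₀) ENNReal.coe_ne_top (fun τ hτ => hC₀ τ hτ.1) hAt.ne hA).2 hs hst htm

/-- **The work of the Clay force is Lipschitz in time, uniformly on `[0, T)`**: ONE `M ≥ 0` with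
`½‖u(t)‖₂² ≤ ½‖u(s)‖₂² + M (t − s)` for all `0 ≤ s ≤ t < T` (energy equality, dissipation `≥ 0`,
`|∫ₛᵗ∫⟪f,u⟫| ≤ √C₀ √E (t − s)` with the UNIFORM energy bound `E` of `energy_le`). No named fact.
[cite: Tao2011, Lemma 8.1] -/
theorem kineticEnergy_sub_le (hν : 0 < ν) :
    ∃ M : ℝ, 0 ≤ M ∧ ∀ s t : ℝ, 0 ≤ s → s ≤ t → t < X.T →
      VectorCalculus.kineticEnergy (X.u t) ≤ VectorCalculus.kineticEnergy (X.u s) + M * (t - s) := by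
  obtain ⟨C₀, hC₀⟩ := X.force_slice_sq_le
  obtain ⟨E, hEt, hE⟩ := X.energy_le hν
  refine ⟨((C₀ : ℝ≥0∞) ^ (1 / 2 : ℝ) * E ^ (1 / 2 : ℝ)).toReal, ENNReal.toReal_nonneg,
    fun s t hs hst ht => ?_⟩
  obtain ⟨h0, htm, hmT⟩ := X.midpoint_slab ⟨hs.trans hst, ht⟩
  have hsol := X.classical_Icc h0 hmT
  have hA : ∀ τ ∈ Icc 0 ((t + X.T) / 2), ∫⁻ x, ‖X.u τ x‖ₑ ^ 2 ≤ E := fun τ hτ =>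
    hE τ ⟨hτ.1, lt_of_le_of_lt hτ.2 hmT⟩
  have hW := hsol.abs_integral_inner_force_le h0 (Cf := C₀) ENNReal.coe_ne_top
    (fun τ hτ => hC₀ τ hτ.1) hEt.ne hA hs hst htm
  have heq := X.energyEq hν hs hst ht
  have hdis : 0 ≤ ν * (∫⁻ τ in Ioo s t,
      ∫⁻ x, ENNReal.ofReal (frobeniusNormSq (fderiv ℝ (X.u τ) x))).toReal :=
    mul_nonneg hν.le ENNReal.toReal_nonneg
  have hle := (abs_le.1 hW).2
  linarith

/-- **THE KINETIC ENERGY OF A CLAY BLOW-UP HAS A LIMIT AT THE LIFESPAN** (`ν > 0`): there is `e`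
with `½‖u(t)‖₂² → e` as `t ↑ T` (`t ↦ ½‖u(t)‖₂² − M t` is antitone and bounded below on `(0, T)`).
The end of the finite-energy classical evolution of Clay data is INVISIBLE in the energy. No named
fact. [cite: Leray1934, §17] -/
theorem tendsto_kineticEnergy (hν : 0 < ν) :
    ∃ e : ℝ, Tendsto (fun t => VectorCalculus.kineticEnergy (X.u t)) (𝓝[<] X.T) (𝓝 e) := by
  obtain ⟨M, hM0, hM⟩ := X.kineticEnergy_sub_le hν
  set φ : ℝ → ℝ := fun t => VectorCalculus.kineticEnergy (X.u t) - M * t with hφ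
  have hanti : AntitoneOn φ (Ioo 0 X.T) := by
    intro s hs t ht hst
    simp only [hφ]
    have := hM s t hs.1.le hst ht.2
    nlinarith
  have hbdd : BddBelow (φ '' Ioo 0 X.T) := by
    refine ⟨-(M * X.T), ?_⟩
    rintro _ ⟨t, ht, rfl⟩
    simp only [hφ]
    have h1 := kineticEnergy_nonneg (X.u t)
    nlinarith [ht.2.le, ht.1.le]
  have hne : (Ioo 0 X.T).Nonempty := nonempty_Ioo.2 X.T_pos
  have hlim := hanti.tendsto_nhdsWithin_Ioo_left hne hbdd
  refine ⟨sInf (φ '' Ioo 0 X.T) + M * X.T, ?_⟩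
  have hid : Tendsto (fun t : ℝ => M * t) (𝓝[<] X.T) (𝓝 (M * X.T)) :=
    ((continuous_const.mul continuous_id).tendsto X.T).mono_left nhdsWithin_le_nhds
  have := hlim.add hid
  refine this.congr fun t => ?_
  simp only [hφ]
  ring

end ClayBlowup

end Summit.NavierStokesRegularity.FluidComputer

end
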